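import Summits.ValiantsHypothesis.ValiantsHypothesis.Theorems.GrenetZeonDualUnipotentThreeHalvesHeavyTopPencilFirstOrder

/-!
# `GrenetZeon.DualUnipotentThreeHalves` (stmt-ValiantsHypothesis-24318), R2 heavy-top instrument — BORDER ORTHOGONALITY
# (Q1-PROOF Level 1 (L1.a)): in a nilpotent space containing `A`, a column border `U` and a row border `W`, `tr(U W A^k) = 0` for all `k`

Experiment cell «val-heavytop-census» (D-0160), engine seat val-htc-eng-2 g3 (kernel-only lane; P-Q1 bricks, director-valiant R336 (5)).
Step (L1.a) of the lead's pencil proof `lead-g2/Q1-PROOF.md` (Q1 «ι(7) ≤ 19»; crux copy `CENSUS-Q1-PROOF.md`): if the graded limit `V_μ`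
of a nilpotent space contains `A = J_{s−1} ⊕ 0`, a column vector `u = Σ u_i E_{is} ∈ V⁺` and a row vector `w = Σ w_j E_{sj} ∈ V⁻`, then
the bordered matrix `A + u + w` is nilpotent and its characteristic polynomial `x^s − Σ_k (wᵀJ^k u) x^{s−2−k}` forces
`wᵀ J^k u = 0` for every `k` («`V⁻ ⊥ ℂ[J]·V⁺`»).  THIS FILE proves the same conclusion WITHOUT determinants, for abstract matrices
`A, U, W` with `U A = 0`, `A W = 0`, `W² = 0` in a space all of whose members have trace-free powers:

* `trace_firstOrder_eq_zero` — the first-order identity FOR TRACES: `(∀ y, tr((A + y B)^m) = 0)`, `m ≥ 1` ⇒ `tr(B A^{m−1}) = 0`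
  (polynomial in `y` with infinitely many roots; its `y¹`-coefficient is `tr(Σ_i A^i B A^{m−1−i}) = m · tr(B A^{m−1})`, via
  ✓ `HeavyTopPencilFirstOrder.coeff_one_C_add_C_mul_X_pow` and `matPolyEquiv`);
* `add_pow_eq_of_mul_eq_zero` — `A W = 0`, `W² = 0` ⇒ `(A + W)^{j+1} = A^{j+1} + W A^j`;
* ★ `trace_mul_mul_pow_eq_zero` — `U A = 0`, `A W = 0`, `W² = 0`, `tr((A + W + y U)^m) = 0` for all `y` and `m ≥ 1` ⇒
  `tr(U W A^k) = 0` for all `k` (take `m = k+2`: `tr(U (A+W)^{k+1}) = tr(U A^{k+1}) + tr(U W A^k) = tr(U W A^k)`);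
* `trace_mul_mul_pow_eq_zero_of_mem` — the same for `A, U, W` in a linear space of nilpotent matrices;
* `border_dotProduct_pow_mulVec_eq_zero` — the bordered reading: `A` with zero last row and column, `U = u ⊗ e_last`, `W = e_last ⊗ w`
  (`w_last = 0`), all of `A + W + yU` nilpotent ⇒ `w ⬝ᵥ (A^k u) = 0` for every `k`.

Honest framing: a lemma for the instrument's kernel port P-Q1 (Level 1); nothing here proves or refutes `HeavyTopLaw`/`HeavyTopSlowLaw`,
24318, S3 or 8062; `VP ≠ VNP` is NOT proved.  No definitions.  [Q1-PROOF (L1.a) (val-htc-lead g2); this seat (determinant-free proof)]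
-/

noncomputable section

-- single-conjunct layout: Sub = Summit, duplicated namespace component intended
set_option linter.dupNamespace false

namespace Summit.ValiantsHypothesis.ValiantsHypothesis.Theorems.GrenetZeon.HeavyTopBorderOrthogonality

open Matrix Polynomial
open Summit.ValiantsHypothesis.ValiantsHypothesis.Theorems.GrenetZeon.HeavyTopPencilFirstOrder (coeff_one_C_add_C_mul_X_pow)

/-! ## The first-order identity for traces -/

/-- Trace commutes with entrywise evaluation of a matrix of polynomials. -/
theorem trace_map_eval {n : Type*} [Fintype n] [DecidableEq n] (Q : Matrix n n ℂ[X]) (x : ℂ) :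
    Matrix.trace (Q.map (Polynomial.eval x)) = (Matrix.trace Q).eval x := by
  simp [Matrix.trace, Polynomial.eval_finsetSum]

/-- `tr(Σ_{i<m} A^i B A^{m−1−i}) = m · tr(B A^{m−1})` (cyclicity of the trace). -/
theorem trace_sum_pow_mul_mul_pow {n : Type*} [Fintype n] [DecidableEq n] (A B : Matrix n n ℂ) (m : ℕ) :
    Matrix.trace (∑ i ∈ Finset.range m, A ^ i * B * A ^ (m - 1 - i)) = (m : ℂ) * Matrix.trace (B * A ^ (m - 1)) := by
  rw [Matrix.trace_sum]
  have h : ∀ i ∈ Finset.range m, Matrix.trace (A ^ i * B * A ^ (m - 1 - i)) = Matrix.trace (B * A ^ (m - 1)) := by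
    intro i hi
    rw [Finset.mem_range] at hi
    rw [Matrix.mul_assoc, Matrix.trace_mul_comm, Matrix.mul_assoc, ← pow_add,
      show m - 1 - i + i = m - 1 by omega]
  rw [Finset.sum_congr rfl h, Finset.sum_const, Finset.card_range, nsmul_eq_mul]

/-- **First-order identity for traces.**  If `tr((A + yB)^m) = 0` for every `y : ℂ` (`m ≥ 1`), then `tr(B A^{m−1}) = 0`. -/
theorem trace_firstOrder_eq_zero {n : Type*} [Fintype n] [DecidableEq n] (A B : Matrix n n ℂ) {m : ℕ} (hm : 1 ≤ m)
    (h : ∀ y : ℂ, Matrix.trace ((A + y • B) ^ m) = 0) : Matrix.trace (B * A ^ (m - 1)) = 0 := by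
  classical
  set P : (Matrix n n ℂ)[X] := C A + C B * X with hP
  set Q : Matrix n n ℂ[X] := matPolyEquiv.symm P with hQ
  have hQx : ∀ y : ℂ, Q.map (Polynomial.eval y) = A + y • B := by
    intro y
    rw [hQ, matPolyEquiv_symm_map_eval, hP, Polynomial.eval_add, Polynomial.eval_C, Polynomial.eval_mul_X,
      Polynomial.eval_C]
    ext i j
    simp [Matrix.scalar_apply, Matrix.mul_diagonal, mul_comm]
  -- the polynomial `tr(Q^m)` vanishes at every `y`, hence is zero
  have htr : Matrix.trace (Q ^ m) = 0 := by
    apply Polynomial.eq_zero_of_infinite_isRoot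
    refine Set.infinite_univ.mono fun y _ => ?_
    rw [Set.mem_setOf_eq, Polynomial.IsRoot, ← trace_map_eval]
    have hmap : (Q ^ m).map (Polynomial.eval y) = (Q.map (Polynomial.eval y)) ^ m := by
      change (Polynomial.evalRingHom y).mapMatrix (Q ^ m) = ((Polynomial.evalRingHom y).mapMatrix Q) ^ m
      exact map_pow _ _ _
    rw [hmap, hQx, h y]
  -- its `X¹`-coefficient is `tr` of the `X¹`-coefficient of `P^m`
  have hc : (Matrix.trace (Q ^ m)).coeff 1 = Matrix.trace ((matPolyEquiv (Q ^ m)).coeff 1) := by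
    simp only [Matrix.trace, Matrix.diag_apply, Polynomial.finsetSum_coeff, matPolyEquiv_coeff_apply]
  rw [htr, Polynomial.coeff_zero, map_pow, hQ, AlgEquiv.apply_symm_apply, hP, coeff_one_C_add_C_mul_X_pow,
    trace_sum_pow_mul_mul_pow] at hc
  have hm0 : (m : ℂ) ≠ 0 := by exact_mod_cast (show m ≠ 0 by omega)
  exact (mul_eq_zero.1 hc.symm).resolve_left hm0

/-! ## Powers of `A + W` when `A W = 0 = W²` -/

/-- `A W = 0`, `W² = 0` ⇒ `(A + W)^{j+1} = A^{j+1} + W A^j` (the only surviving words are `A⋯A` and `W A⋯A`). -/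
theorem add_pow_eq_of_mul_eq_zero {n : Type*} [Fintype n] [DecidableEq n] (A W : Matrix n n ℂ) (hAW : A * W = 0)
    (hWW : W * W = 0) (j : ℕ) : (A + W) ^ (j + 1) = A ^ (j + 1) + W * A ^ j := by
  induction j with
  | zero => simp
  | succ j ih =>
    rw [pow_succ, ih, add_mul, mul_add, mul_add, ← pow_succ]
    have h1 : A ^ (j + 1) * W = 0 := by rw [pow_succ, Matrix.mul_assoc, hAW, Matrix.mul_zero]
    have h2 : W * A ^ j * W = 0 := by
      cases j with
      | zero => rw [pow_zero, Matrix.mul_one, hWW]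
      | succ j => rw [pow_succ, Matrix.mul_assoc, Matrix.mul_assoc, hAW, Matrix.mul_zero, Matrix.mul_zero]
    rw [h1, h2, add_zero, add_zero, Matrix.mul_assoc, ← pow_succ]

/-! ## Border orthogonality -/

/-- ★ **Border orthogonality, abstract form.**  If `U A = 0`, `A W = 0`, `W² = 0` and every power of every `A + W + yU` is
trace-free, then `tr(U W A^k) = 0` for every `k`. [Q1-PROOF (L1.a); determinant-free] -/
theorem trace_mul_mul_pow_eq_zero {n : Type*} [Fintype n] [DecidableEq n] (A U W : Matrix n n ℂ) (hUA : U * A = 0)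
    (hAW : A * W = 0) (hWW : W * W = 0)
    (h : ∀ y : ℂ, ∀ m : ℕ, 1 ≤ m → Matrix.trace ((A + W + y • U) ^ m) = 0) (k : ℕ) :
    Matrix.trace (U * W * A ^ k) = 0 := by
  have h1 := trace_firstOrder_eq_zero (A + W) U (m := k + 2) (by omega) (fun y => h y (k + 2) (by omega))
  rw [show k + 2 - 1 = k + 1 by omega, add_pow_eq_of_mul_eq_zero A W hAW hWW k, mul_add, Matrix.trace_add,
    pow_succ', ← Matrix.mul_assoc, hUA, Matrix.zero_mul, Matrix.trace_zero, zero_add, ← Matrix.mul_assoc] at h1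
  exact h1

/-- **Border orthogonality in a nilpotent space.**  If every member of the linear space `V ≤ M_n(ℂ)` is nilpotent and `A, U, W ∈ V`
with `U A = 0`, `A W = 0`, `W² = 0`, then `tr(U W A^k) = 0` for every `k`. [Q1-PROOF (L1.a)] -/
theorem trace_mul_mul_pow_eq_zero_of_mem {n : Type*} [Fintype n] [DecidableEq n] (V : Submodule ℂ (Matrix n n ℂ))
    (hV : ∀ M ∈ V, IsNilpotent M) {A U W : Matrix n n ℂ} (hA : A ∈ V) (hU : U ∈ V) (hW : W ∈ V) (hUA : U * A = 0)
    (hAW : A * W = 0) (hWW : W * W = 0) (k : ℕ) : Matrix.trace (U * W * A ^ k) = 0 := by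
  refine trace_mul_mul_pow_eq_zero A U W hUA hAW hWW (fun y m _ => ?_) k
  have hmem : A + W + y • U ∈ V := V.add_mem (V.add_mem hA hW) (V.smul_mem y hU)
  exact (Matrix.isNilpotent_trace_of_isNilpotent ((hV _ hmem).pow_of_pos (by omega))).eq_zero

/-- **Bordered reading.**  Let `A` have zero last row and zero last column, `u`, `w` vectors with `w_last = 0`,
`U := u ⊗ e_last` (the column border: `U x = x_last u`) and `W := e_last ⊗ w` (the row border: `W x = (w·x) e_last`).  If
`A + W + yU` is nilpotent for every `y`, then `w ⬝ᵥ A^k u = 0` for every `k` — the vanishing of the coefficients `wᵀJ^k u` of the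
bordered characteristic polynomial `x^{s+1} − Σ_k (wᵀA^k u) x^{s−1−k}`. [Q1-PROOF (L1.a)] -/
theorem border_dotProduct_pow_mulVec_eq_zero {s : ℕ} (A : Matrix (Fin (s + 1)) (Fin (s + 1)) ℂ) (u w : Fin (s + 1) → ℂ)
    (hrow : ∀ j, A (Fin.last s) j = 0) (hcol : ∀ i, A i (Fin.last s) = 0) (hw : w (Fin.last s) = 0)
    (h : ∀ y : ℂ, IsNilpotent (A + vecMulVec (Pi.single (Fin.last s) 1) w + y • vecMulVec u (Pi.single (Fin.last s) 1)))
    (k : ℕ) : w ⬝ᵥ (A ^ k *ᵥ u) = 0 := by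
  classical
  set U : Matrix (Fin (s + 1)) (Fin (s + 1)) ℂ := vecMulVec u (Pi.single (Fin.last s) 1) with hUdef
  set W : Matrix (Fin (s + 1)) (Fin (s + 1)) ℂ := vecMulVec (Pi.single (Fin.last s) 1) w with hWdef
  have hUA : U * A = 0 := by
    ext i j
    simp [hUdef, Matrix.mul_apply, vecMulVec_apply, Pi.single_apply, hrow]
  have hAW : A * W = 0 := by
    ext i j
    simp [hWdef, Matrix.mul_apply, vecMulVec_apply, Pi.single_apply, hcol]
  have hWW : W * W = 0 := by
    ext i j
    simp [hWdef, Matrix.mul_apply, vecMulVec_apply, Pi.single_apply, hw]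
  have htr : ∀ y : ℂ, ∀ m : ℕ, 1 ≤ m → Matrix.trace ((A + W + y • U) ^ m) = 0 := fun y m hm =>
    (Matrix.isNilpotent_trace_of_isNilpotent ((h y).pow_of_pos (by omega))).eq_zero
  have h1 := trace_mul_mul_pow_eq_zero A U W hUA hAW hWW htr k
  -- `U W = u ⊗ w` and `tr((u ⊗ w) A^k) = w ⬝ᵥ A^k u`
  have hUW : U * W = vecMulVec u w := by
    ext i j
    simp [hUdef, hWdef, Matrix.mul_apply, vecMulVec_apply, Pi.single_apply]
  rw [hUW] at h1
  rw [← h1, Matrix.trace, dotProduct]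
  simp only [Matrix.diag_apply, Matrix.mul_apply, vecMulVec_apply, Matrix.mulVec, dotProduct]
  rw [Finset.sum_comm]
  refine Finset.sum_congr rfl fun j _ => ?_
  rw [Finset.mul_sum]
  refine Finset.sum_congr rfl fun i _ => ?_
  ring

end Summit.ValiantsHypothesis.ValiantsHypothesis.Theorems.GrenetZeon.HeavyTopBorderOrthogonality

end
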